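import Summits.AnomalousDissipation.AnomalousDissipation.Theorems.MomentParityQuarticGateDesignSums

/-!
# The explicit order-2 design: mean energy and mean enstrophy

Helper file for stub S6 (`stub_order2Design`) of the line `recession-cone` of crux
`MomentParity.QuarticGate`, continuing `MomentParityQuarticGateDesignSums` (same coefficient
families, passed as variables with defining hypotheses). For a real frequency weight `r` the
weighted energy `∑_atoms ∑_{k∈S} r_k ‖ĉ k‖²` of the design splits (two-sign polarisation, disjoint
frequency supports of `cf`, `cA m`, `cB m`) into single-mode contributions; with `r = 1` this
bounds the MEAN ENERGY, with `r = |k|²` it computes the MEAN ENSTROPHY exactly (the dissipation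
carrier `cC` contributes `N² c²/2`, which is how the amplitude `c` is tuned in the final assembly).
-/

namespace Summit.AnomalousDissipation.AnomalousDissipation.Theorems.MomentParityQuarticGate

open MeasureTheory Filter Complex
open scoped InnerProductSpace ComplexConjugate
open Literature.Analysis.FunctionSpaces Literature.Analysis.FluidPDE

set_option linter.dupNamespace false

section Budget

variable {N : ℕ} {A₁ B₂ c η : ℝ}
  {cf cC : (Fin 3 → ℤ) → EuclideanSpace ℂ (Fin 3)} {cA cB : Fin 4 → (Fin 3 → ℤ) → EuclideanSpace ℂ (Fin 3)}
  {cR : Torus.FrameIdx (Fin 3) N → (Fin 3 → ℤ) → EuclideanSpace ℂ (Fin 3)}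
  (hcf : cf = (Pi.single (![0, 1, 0] : Fin 3 → ℤ) (((1 / 2 : ℂ)) • EuclideanSpace.complexify (WithLp.toLp 2 ![(1 : ℝ), 0, 0] : EuclideanSpace ℝ (Fin 3))) +
        Pi.single (-(![0, 1, 0] : Fin 3 → ℤ)) ((starRingEnd ℂ) ((1 / 2 : ℂ)) • EuclideanSpace.complexify (WithLp.toLp 2 ![(1 : ℝ), 0, 0] : EuclideanSpace ℝ (Fin 3))) : (Fin 3 → ℤ) → EuclideanSpace ℂ (Fin 3)))
  (hcA : cA = fun m : Fin 4 => (Pi.single (![0, 0, 1] : Fin 3 → ℤ) ((((A₁ / 2 : ℝ) : ℂ) * Complex.I ^ (m : ℕ)) • EuclideanSpace.complexify (WithLp.toLp 2 ![(1 : ℝ), 0, 0] : EuclideanSpace ℝ (Fin 3))) +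
        Pi.single (-(![0, 0, 1] : Fin 3 → ℤ)) ((starRingEnd ℂ) (((A₁ / 2 : ℝ) : ℂ) * Complex.I ^ (m : ℕ)) • EuclideanSpace.complexify (WithLp.toLp 2 ![(1 : ℝ), 0, 0] : EuclideanSpace ℝ (Fin 3))) : (Fin 3 → ℤ) → EuclideanSpace ℂ (Fin 3)))
  (hcB : cB = fun m : Fin 4 => (Pi.single (![0, 1, 1] : Fin 3 → ℤ) ((((B₂ / 2 : ℝ) : ℂ) * -Complex.I * Complex.I ^ (m : ℕ)) • EuclideanSpace.complexify (WithLp.toLp 2 ![(0 : ℝ), 1, -1] : EuclideanSpace ℝ (Fin 3))) +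
        Pi.single (-(![0, 1, 1] : Fin 3 → ℤ)) ((starRingEnd ℂ) (((B₂ / 2 : ℝ) : ℂ) * -Complex.I * Complex.I ^ (m : ℕ)) • EuclideanSpace.complexify (WithLp.toLp 2 ![(0 : ℝ), 1, -1] : EuclideanSpace ℝ (Fin 3))) : (Fin 3 → ℤ) → EuclideanSpace ℂ (Fin 3)))
  (hcC : cC = (Pi.single (![0, 0, (N : ℤ)] : Fin 3 → ℤ) ((((c / 2 : ℝ) : ℂ)) • EuclideanSpace.complexify (WithLp.toLp 2 ![(1 : ℝ), 0, 0] : EuclideanSpace ℝ (Fin 3))) +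
        Pi.single (-(![0, 0, (N : ℤ)] : Fin 3 → ℤ)) ((starRingEnd ℂ) (((c / 2 : ℝ) : ℂ)) • EuclideanSpace.complexify (WithLp.toLp 2 ![(1 : ℝ), 0, 0] : EuclideanSpace ℝ (Fin 3))) : (Fin 3 → ℤ) → EuclideanSpace ℂ (Fin 3)))
  (hcR : cR = fun a : Torus.FrameIdx (Fin 3) N => (Pi.single (a.1 : Fin 3 → ℤ) ((((η / 2 : ℝ) : ℂ) * (if a.2.2 then (1 : ℂ) else -Complex.I)) • EuclideanSpace.complexify (Torus.perpVec (a.1 : Fin 3 → ℤ) a.2.1)) +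
        Pi.single (-(a.1 : Fin 3 → ℤ)) ((starRingEnd ℂ) (((η / 2 : ℝ) : ℂ) * (if a.2.2 then (1 : ℂ) else -Complex.I)) • EuclideanSpace.complexify (Torus.perpVec (a.1 : Fin 3 → ℤ) a.2.1)) : (Fin 3 → ℤ) → EuclideanSpace ℂ (Fin 3)))

/-! ## Splitting of weighted energies over the design -/

include hcf hcA hcB in
/-- The weighted energy of the deterministic part splits into its three modes (pairwise disjoint
frequency supports). [folklore] -/
theorem design_weighted_P (r : (Fin 3 → ℤ) → ℝ) (m : Fin 4) :
    (∑ k ∈ ((Torus.freqBall N).erase 0), r k * ‖((cf + cA m + cB m)) k‖ ^ 2) =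
      (∑ k ∈ ((Torus.freqBall N).erase 0), r k * ‖(cf) k‖ ^ 2) + (∑ k ∈ ((Torus.freqBall N).erase 0), r k * ‖(cA m) k‖ ^ 2) + (∑ k ∈ ((Torus.freqBall N).erase 0), r k * ‖(cB m) k‖ ^ 2) := by
  obtain ⟨hF0, hA0, hB0, hAF, hAF', hBF, hBF', hBA, hBA', -⟩ := design_freq_facts
  obtain ⟨hadd₁, hadd₂, -, -⟩ := weightedForm_biadditive ((Torus.freqBall N).erase 0) (fun k => ((r k : ℝ) : ℂ))
  rw [sum_mul_norm_sq_eq_sum_re_inner, sum_mul_norm_sq_eq_sum_re_inner, sum_mul_norm_sq_eq_sum_re_inner,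
    sum_mul_norm_sq_eq_sum_re_inner,
    biadditive_apply_add_three (fun x y : (Fin 3 → ℤ) → EuclideanSpace ℂ (Fin 3) =>
      ∑ k ∈ ((Torus.freqBall N).erase 0), (inner ℂ (x k) (((r k : ℝ) : ℂ) • y k)).re) hadd₁ hadd₂]
  all_goals subst hcf hcA hcB
  · exact sum_re_inner_eq_zero_of_disjoint (fun k z => ((r k : ℝ) : ℂ) • z) (fun _ => smul_zero _)
      (single_add_single_disjoint hAF hAF' _ _ _ _)
  · exact sum_re_inner_eq_zero_of_disjoint (fun k z => ((r k : ℝ) : ℂ) • z) (fun _ => smul_zero _)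
      (single_add_single_disjoint hBF hBF' _ _ _ _)
  · exact sum_re_inner_eq_zero_of_disjoint (fun k z => ((r k : ℝ) : ℂ) • z) (fun _ => smul_zero _)
      fun k => (single_add_single_disjoint hAF hAF' _ _ _ _ k).symm
  · exact sum_re_inner_eq_zero_of_disjoint (fun k z => ((r k : ℝ) : ℂ) • z) (fun _ => smul_zero _)
      (single_add_single_disjoint hBA hBA' _ _ _ _)
  · exact sum_re_inner_eq_zero_of_disjoint (fun k z => ((r k : ℝ) : ℂ) • z) (fun _ => smul_zero _)
      fun k => (single_add_single_disjoint hBF hBF' _ _ _ _ k).symm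
  · exact sum_re_inner_eq_zero_of_disjoint (fun k z => ((r k : ℝ) : ℂ) • z) (fun _ => smul_zero _)
      fun k => (single_add_single_disjoint hBA hBA' _ _ _ _ k).symm

include hcf hcA hcB in
/-- **Splitting of the weighted energy over the design**: two-sign polarisation separates the
deterministic part, the dissipation carrier and the noise, and the deterministic part splits into
its three modes. [folklore] -/
theorem design_sum_weighted (r : (Fin 3 → ℤ) → ℝ) :
    ∑ p : (Fin 4 × Torus.FrameIdx (Fin 3) N × Bool × Bool), ∑ k ∈ ((Torus.freqBall N).erase 0), r k * ‖(cf + cA p.1 + cB p.1 + (if p.2.2.1 then (1 : ℝ) else -1) • cC + (if p.2.2.2 then (1 : ℝ) else -1) • cR p.2.1) k‖ ^ 2 =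
      4 * (Fintype.card (Torus.FrameIdx (Fin 3) N) : ℝ) *
          ∑ m : Fin 4, ((∑ k ∈ ((Torus.freqBall N).erase 0), r k * ‖(cf) k‖ ^ 2) + (∑ k ∈ ((Torus.freqBall N).erase 0), r k * ‖(cA m) k‖ ^ 2) + (∑ k ∈ ((Torus.freqBall N).erase 0), r k * ‖(cB m) k‖ ^ 2)) +
        16 * (Fintype.card (Torus.FrameIdx (Fin 3) N) : ℝ) * (∑ k ∈ ((Torus.freqBall N).erase 0), r k * ‖(cC) k‖ ^ 2) +
        16 * ∑ a : Torus.FrameIdx (Fin 3) N, (∑ k ∈ ((Torus.freqBall N).erase 0), r k * ‖(cR a) k‖ ^ 2) := by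
  obtain ⟨hadd₁, hadd₂, hneg₁, hneg₂⟩ := weightedForm_biadditive ((Torus.freqBall N).erase 0) (fun k => ((r k : ℝ) : ℂ))
  have hinner : ∀ (m : Fin 4) (a : Torus.FrameIdx (Fin 3) N),
      ∑ s : Bool × Bool, ∑ k ∈ ((Torus.freqBall N).erase 0), r k *
        ‖(cf + cA m + cB m + (if s.1 then (1 : ℝ) else -1) • cC + (if s.2 then (1 : ℝ) else -1) • cR a) k‖ ^ 2 =
      4 * (((∑ k ∈ ((Torus.freqBall N).erase 0), r k * ‖(cf) k‖ ^ 2) + (∑ k ∈ ((Torus.freqBall N).erase 0), r k * ‖(cA m) k‖ ^ 2) + (∑ k ∈ ((Torus.freqBall N).erase 0), r k * ‖(cB m) k‖ ^ 2)) + (∑ k ∈ ((Torus.freqBall N).erase 0), r k * ‖(cC) k‖ ^ 2) + (∑ k ∈ ((Torus.freqBall N).erase 0), r k * ‖(cR a) k‖ ^ 2)) := by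
    intro m a
    rw [Fintype.sum_prod_type]
    dsimp only
    conv_lhs => simp only [sum_mul_norm_sq_eq_sum_re_inner]
    rw [sum_sign_sign_biadditive (fun x y : (Fin 3 → ℤ) → EuclideanSpace ℂ (Fin 3) =>
        ∑ k ∈ ((Torus.freqBall N).erase 0), (inner ℂ (x k) (((r k : ℝ) : ℂ) • y k)).re) hadd₁ hadd₂ hneg₁ hneg₂]
    simp only [← sum_mul_norm_sq_eq_sum_re_inner]
    rw [design_weighted_P hcf hcA hcB r m, nsmul_eq_mul]
    norm_num
  rw [Fintype.sum_prod_type]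
  simp_rw [Fintype.sum_prod_type (f := fun q : Torus.FrameIdx (Fin 3) N × Bool × Bool =>
    ∑ k ∈ ((Torus.freqBall N).erase 0), r k *
      ‖(cf + cA _ + cB _ + (if q.2.1 then (1 : ℝ) else -1) • cC + (if q.2.2 then (1 : ℝ) else -1) • cR q.1) k‖ ^ 2)]
  simp_rw [hinner]
  simp only [mul_add, Finset.sum_add_distrib, Finset.sum_const, Finset.card_univ, Fintype.card_fin,
    nsmul_eq_mul, ← Finset.mul_sum]
  push_cast
  ring

/-! ## Norms of the design amplitudes -/

/-- Norms of the design vectors and phases. [folklore] -/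
theorem design_norms (A₁ B₂ c η : ℝ) (m : ℕ) (b : Bool) :
    ‖(WithLp.toLp 2 ![(1 : ℝ), 0, 0] : EuclideanSpace ℝ (Fin 3))‖ ^ 2 = 1 ∧
      ‖(WithLp.toLp 2 ![(0 : ℝ), 1, -1] : EuclideanSpace ℝ (Fin 3))‖ ^ 2 = 2 ∧
      ‖(1 / 2 : ℂ)‖ ^ 2 = 1 / 4 ∧
      ‖((A₁ / 2 : ℝ) : ℂ) * Complex.I ^ m‖ ^ 2 = A₁ ^ 2 / 4 ∧
      ‖((B₂ / 2 : ℝ) : ℂ) * -Complex.I * Complex.I ^ m‖ ^ 2 = B₂ ^ 2 / 4 ∧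
      ‖((c / 2 : ℝ) : ℂ)‖ ^ 2 = c ^ 2 / 4 ∧
      ‖((η / 2 : ℝ) : ℂ) * (if b then (1 : ℂ) else -Complex.I)‖ ^ 2 = η ^ 2 / 4 := by
  have hph : ‖(if b then (1 : ℂ) else -Complex.I)‖ = 1 := by cases b <;> simp
  refine ⟨?_, ?_, ?_, ?_, ?_, ?_, ?_⟩
  · simp [EuclideanSpace.norm_sq_eq, Fin.sum_univ_three]
  · simp [EuclideanSpace.norm_sq_eq, Fin.sum_univ_three]
    norm_num
  · simp
    norm_num
  · rw [norm_mul, norm_pow, Complex.norm_I, one_pow, mul_one, Complex.norm_real, Real.norm_eq_abs, sq_abs]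
    ring
  · rw [norm_mul, norm_mul, norm_pow, Complex.norm_I, one_pow, mul_one, norm_neg, Complex.norm_I, mul_one,
      Complex.norm_real, Real.norm_eq_abs, sq_abs]
    ring
  · rw [Complex.norm_real, Real.norm_eq_abs, sq_abs]
    ring
  · rw [norm_mul, hph, mul_one, Complex.norm_real, Real.norm_eq_abs, sq_abs]
    ring

/-! ## Mean energy -/

include hcf hcA hcB hcC hcR in
/-- **Mean energy of the design**:
`∑_atoms ∑_{k∈S} ‖ĉ k‖² ≤ #ι · (1/2 + A₁²/2 + B₂² + c²/2 + η²/2)`. [folklore] -/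
theorem design_sum_energy_le (hN : 2 ≤ N) :
    ∑ p : (Fin 4 × Torus.FrameIdx (Fin 3) N × Bool × Bool), ∑ k ∈ ((Torus.freqBall N).erase 0), ‖(cf + cA p.1 + cB p.1 + (if p.2.2.1 then (1 : ℝ) else -1) • cC + (if p.2.2.2 then (1 : ℝ) else -1) • cR p.2.1) k‖ ^ 2 ≤
      ((Fintype.card (Fin 4 × Torus.FrameIdx (Fin 3) N × Bool × Bool) : ℕ) : ℝ) * (1 / 2 + A₁ ^ 2 / 2 + B₂ ^ 2 + c ^ 2 / 2 + η ^ 2 / 2) := by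
  obtain ⟨hkF, hnkF, hkA, hnkA, hkB, hnkB, hkC, hnkC⟩ := design_mem hN
  obtain ⟨hF0, hA0, hB0, -⟩ := design_freq_facts
  have hC0 : (![0, 0, (N : ℤ)] : Fin 3 → ℤ) ≠ 0 := (Finset.mem_erase.1 hkC).1
  have h := design_sum_weighted (cC := cC) (cR := cR) hcf hcA hcB (fun _ => (1 : ℝ))
  simp only [one_mul] at h
  have hW : ∀ m : Fin 4, ∑ k ∈ ((Torus.freqBall N).erase 0), ‖(cf) k‖ ^ 2 + ∑ k ∈ ((Torus.freqBall N).erase 0), ‖(cA m) k‖ ^ 2 + ∑ k ∈ ((Torus.freqBall N).erase 0), ‖(cB m) k‖ ^ 2 = 1 / 2 + A₁ ^ 2 / 2 + B₂ ^ 2 := by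
    intro m
    obtain ⟨ne, nb, n1, nA, nB, -, -⟩ := design_norms A₁ B₂ c η (m : ℕ) true
    rw [hcf, hcA, hcB]
    dsimp only
    rw [sum_norm_sq_polarised hkF hnkF hF0, sum_norm_sq_polarised hkA hnkA hA0, sum_norm_sq_polarised hkB hnkB hB0,
      ne, nb, n1, nA, nB]
    ring
  have hQ : ∑ k ∈ ((Torus.freqBall N).erase 0), ‖(cC) k‖ ^ 2 = c ^ 2 / 2 := by
    obtain ⟨ne, -, -, -, -, nC, -⟩ := design_norms A₁ B₂ c η 0 true
    rw [hcC, sum_norm_sq_polarised hkC hnkC hC0, ne, nC]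
    ring
  have hR : ∀ a : Torus.FrameIdx (Fin 3) N, ∑ k ∈ ((Torus.freqBall N).erase 0), ‖(cR a) k‖ ^ 2 ≤ η ^ 2 / 2 := by
    intro a
    obtain ⟨-, -, -, -, -, -, nR⟩ := design_norms A₁ B₂ c η 0 a.2.2
    have ha : (a.1 : Fin 3 → ℤ) ∈ ((Torus.freqBall N).erase 0) := a.1.2
    rw [hcR]
    dsimp only
    rw [sum_norm_sq_polarised ha (neg_mem_freqBall_erase_zero _ ha) (Torus.ne_zero_of_mem_freqBall₀ _), nR]
    have := norm_sq_perpVec_le (a.1 : Fin 3 → ℤ) a.2.1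
    nlinarith [sq_nonneg η]
  have hRsum : ∑ a : Torus.FrameIdx (Fin 3) N, ∑ k ∈ ((Torus.freqBall N).erase 0), ‖(cR a) k‖ ^ 2 ≤
      (Fintype.card (Torus.FrameIdx (Fin 3) N) : ℝ) * (η ^ 2 / 2) := by
    refine (Finset.sum_le_sum fun a _ => hR a).trans ?_
    rw [Finset.sum_const, Finset.card_univ, nsmul_eq_mul]
  have hcard : ((Fintype.card (Fin 4 × Torus.FrameIdx (Fin 3) N × Bool × Bool) : ℕ) : ℝ) =
      16 * (Fintype.card (Torus.FrameIdx (Fin 3) N) : ℝ) := by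
    rw [Fintype.card_prod (Fin 4), Fintype.card_prod (Torus.FrameIdx (Fin 3) N), Fintype.card_prod Bool Bool,
      Fintype.card_bool, Fintype.card_fin]
    push_cast
    ring
  rw [h, hcard]
  simp_rw [hW, hQ]
  simp only [Finset.sum_const, Finset.card_univ, Fintype.card_fin, nsmul_eq_mul]
  push_cast
  nlinarith [hRsum]


/-! ## Mean enstrophy -/

include hcR in
/-- **Enstrophy of a noise atom**: `∑ |k|² ‖cR a k‖² = |k_a|² (η²/2) ‖perpVec‖²`. [folklore] -/
theorem design_enstrophy_R (a : Torus.FrameIdx (Fin 3) N) :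
    ∑ k ∈ ((Torus.freqBall N).erase 0), Torus.freqNormSq k * ‖(cR a) k‖ ^ 2 =
      Torus.freqNormSq (a.1 : Fin 3 → ℤ) * (η ^ 2 / 2) * ‖Torus.perpVec (a.1 : Fin 3 → ℤ) a.2.1‖ ^ 2 := by
  obtain ⟨-, -, -, -, -, -, nR⟩ := design_norms 0 0 0 η 0 a.2.2
  have ha : (a.1 : Fin 3 → ℤ) ∈ ((Torus.freqBall N).erase 0) := a.1.2
  rw [hcR]
  dsimp only
  rw [sum_freqNormSq_mul_norm_sq_polarised ha (neg_mem_freqBall_erase_zero _ ha) (Torus.ne_zero_of_mem_freqBall₀ _), nR]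
  ring

include hcR in
/-- **The noise enstrophy is at most `#A · N²η²/2`.** [folklore] -/
theorem design_sum_enstrophy_R_le :
    ∑ a : Torus.FrameIdx (Fin 3) N, ∑ k ∈ ((Torus.freqBall N).erase 0), Torus.freqNormSq k * ‖(cR a) k‖ ^ 2 ≤
      (Fintype.card (Torus.FrameIdx (Fin 3) N) : ℝ) * ((N : ℝ) ^ 2 * η ^ 2 / 2) := by
  have hR : ∀ a : Torus.FrameIdx (Fin 3) N, ∑ k ∈ ((Torus.freqBall N).erase 0), Torus.freqNormSq k * ‖(cR a) k‖ ^ 2 ≤ (N : ℝ) ^ 2 * η ^ 2 / 2 := by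
    intro a
    rw [design_enstrophy_R hcR a]
    have h1 := norm_sq_perpVec_le (a.1 : Fin 3 → ℤ) a.2.1
    have h2 : Torus.freqNormSq (a.1 : Fin 3 → ℤ) ≤ (N : ℝ) ^ 2 :=
      Torus.mem_freqBall.1 (Finset.mem_of_mem_erase a.1.2)
    have h3 := Torus.freqNormSq_nonneg (a.1 : Fin 3 → ℤ)
    calc Torus.freqNormSq (a.1 : Fin 3 → ℤ) * (η ^ 2 / 2) * ‖Torus.perpVec (a.1 : Fin 3 → ℤ) a.2.1‖ ^ 2
        ≤ Torus.freqNormSq (a.1 : Fin 3 → ℤ) * (η ^ 2 / 2) * 1 := by gcongr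
      _ ≤ (N : ℝ) ^ 2 * (η ^ 2 / 2) * 1 := by gcongr
      _ = (N : ℝ) ^ 2 * η ^ 2 / 2 := by ring
  refine (Finset.sum_le_sum fun a _ => hR a).trans ?_
  rw [Finset.sum_const, Finset.card_univ, nsmul_eq_mul]

include hcf hcA hcB hcC in
/-- **Mean enstrophy of the design (exact)**:
`∑_atoms ∑_{k∈S} |k|² ‖ĉ k‖² = #ι · (1/2 + A₁²/2 + 2B₂² + N²c²/2) + 16 ∑_a ∑ |k|²‖cR a k‖²`. [folklore] -/
theorem design_sum_enstrophy (hN : 2 ≤ N) :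
    ∑ p : (Fin 4 × Torus.FrameIdx (Fin 3) N × Bool × Bool), ∑ k ∈ ((Torus.freqBall N).erase 0), Torus.freqNormSq k * ‖(cf + cA p.1 + cB p.1 + (if p.2.2.1 then (1 : ℝ) else -1) • cC + (if p.2.2.2 then (1 : ℝ) else -1) • cR p.2.1) k‖ ^ 2 =
      ((Fintype.card (Fin 4 × Torus.FrameIdx (Fin 3) N × Bool × Bool) : ℕ) : ℝ) *
          (1 / 2 + A₁ ^ 2 / 2 + 2 * B₂ ^ 2 + (N : ℝ) ^ 2 * c ^ 2 / 2) +
        16 * ∑ a : Torus.FrameIdx (Fin 3) N, ∑ k ∈ ((Torus.freqBall N).erase 0), Torus.freqNormSq k * ‖(cR a) k‖ ^ 2 := by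
  obtain ⟨hkF, hnkF, hkA, hnkA, hkB, hnkB, hkC, hnkC⟩ := design_mem hN
  obtain ⟨hF0, hA0, hB0, -⟩ := design_freq_facts
  obtain ⟨nF, nA', nB', nC'⟩ := design_freqNormSq N
  have hC0 : (![0, 0, (N : ℤ)] : Fin 3 → ℤ) ≠ 0 := (Finset.mem_erase.1 hkC).1
  have h := design_sum_weighted (cC := cC) (cR := cR) hcf hcA hcB Torus.freqNormSq
  have hW : ∀ m : Fin 4, ∑ k ∈ ((Torus.freqBall N).erase 0), Torus.freqNormSq k * ‖(cf) k‖ ^ 2 + ∑ k ∈ ((Torus.freqBall N).erase 0), Torus.freqNormSq k * ‖(cA m) k‖ ^ 2 + ∑ k ∈ ((Torus.freqBall N).erase 0), Torus.freqNormSq k * ‖(cB m) k‖ ^ 2 = 1 / 2 + A₁ ^ 2 / 2 + 2 * B₂ ^ 2 := by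
    intro m
    obtain ⟨ne, nb, n1, nA, nB, -, -⟩ := design_norms A₁ B₂ c 0 (m : ℕ) true
    rw [hcf, hcA, hcB]
    dsimp only
    rw [sum_freqNormSq_mul_norm_sq_polarised hkF hnkF hF0, sum_freqNormSq_mul_norm_sq_polarised hkA hnkA hA0,
      sum_freqNormSq_mul_norm_sq_polarised hkB hnkB hB0, ne, nb, n1, nA, nB, nF, nA', nB']
    ring
  have hQ : ∑ k ∈ ((Torus.freqBall N).erase 0), Torus.freqNormSq k * ‖(cC) k‖ ^ 2 = (N : ℝ) ^ 2 * c ^ 2 / 2 := by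
    obtain ⟨ne, -, -, -, -, nC, -⟩ := design_norms A₁ B₂ c 0 0 true
    rw [hcC, sum_freqNormSq_mul_norm_sq_polarised hkC hnkC hC0, ne, nC, nC']
    ring
  have hcard : ((Fintype.card (Fin 4 × Torus.FrameIdx (Fin 3) N × Bool × Bool) : ℕ) : ℝ) =
      16 * (Fintype.card (Torus.FrameIdx (Fin 3) N) : ℝ) := by
    rw [Fintype.card_prod (Fin 4), Fintype.card_prod (Torus.FrameIdx (Fin 3) N), Fintype.card_prod Bool Bool,
      Fintype.card_bool, Fintype.card_fin]
    push_cast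
    ring
  rw [h, hcard]
  simp_rw [hW, hQ]
  simp only [Finset.sum_const, Finset.card_univ, Fintype.card_fin, nsmul_eq_mul]
  push_cast
  ring

end Budget

/-- **Registered sub-goal `designBudget_phase_norm` of stub S6** (summary of this file's norm
bookkeeping): the noise amplitudes `(η/2)·phase` have squared norm `η²/4`. [folklore] -/
theorem designBudget_phase_norm : ∀ (η : ℝ) (b : Bool), ‖((η / 2 : ℝ) : ℂ) * (if b then (1 : ℂ) else -Complex.I)‖ ^ 2 = η ^ 2 / 4 :=
  fun η b => (design_norms 0 0 0 η 0 b).2.2.2.2.2.2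

end Summit.AnomalousDissipation.AnomalousDissipation.Theorems.MomentParityQuarticGate
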